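import Summits.CriticalPhenomena.PercolationContinuityZ3.Theorems.Transplant.FKConnectivityAllQClusterDom
import HarnessLib

/-!
# Connectivity correlation inequalities for `φ_{w,q}`, every `q > 0` — POSITIVE ASSOCIATION OF THE CLUSTER PARTITION
# (conjecture node; the `q ≥ 1` case; it contains cluster association, the hub inequality and pairwise positive correlation of
# connection events)

Support file (`--supports stmt-CriticalPhenomena-4575`), FK sub-lane `prim-bschramm-fk-1` (gen 7) of the post-continuity
programme; builds on p205010 (kernel theorem, internal audit signed; external expert review pending).  Definitions (`connSet`,
`partIn`, `PartitionAssocOn/FK`, one `@[conjecture]` node — NOT asserted), no named facts, no sorries; standard axioms.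

FINDING OF THIS SEAT (exact rational computation, bschramm/FROM-fk-1-g7-CLUSTER-DOMINANCE.md §5).  Record the partition of the
vertices into open clusters by its set of connected pairs `connSet ω = {uv : u ↔ v}`; the coarsening order of partitions is inclusion
of these sets.  **PA**: for every `q > 0` and every finite weighted graph the law of the cluster partition under `φ_{w,q}` is
POSITIVELY ASSOCIATED in the coarsening order: `φ(π ∈ 𝒰)·φ(π ∈ 𝒱) ≤ φ(π ∈ 𝒰 ∩ 𝒱)` for all up-sets `𝒰, 𝒱` of pair-sets.  For `q ≥ 1`
this is FKG (the partition is increasing in `ω`); for `0 < q < 1` the EDGES are (conjecturally) negatively correlated and edge events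
are not partition-measurable, so there is no contradiction — and the partition is NOT stochastically monotone in a (non-adjacent)
edge for `q < 1` (memo §3), so PA is association WITHOUT a monotone coupling.  Evidence: 0 violations in 6,000 exact covariances
(random weighted graphs on `≤ 7` vertices, `q` from `10⁻³` to `19/20`, up-sets generated by up to three partitions each) and, in the
coefficientwise/levelwise form on the double model `q^{k(S)+k(E∖S)}` ('given the red partition is coarse, red dominates blue'),
0 violations in 17,850 level tests.  PA contains: cluster association CA (`clusterAssocOn_of_partitionAssocOn`), hence the hub
inequality (13) of Ayyer–Linusson–Ravichandran; pairwise positive correlation of connection events (`pairConnPosUnder_of_partitionAssocOn`,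
fk-1 g4's node `PairConnPosFKPos`); ALR state (13) as open even for the arboreal gas and conjecture the hub form (their Conj. 7.1).
[cite: AyyerLinussonRavichandran2025, §2.4, §7 eq. (13)–(15), Conj. 7.1 (pp. 12, 22)] [cite: Grimmett2006, Thm. (3.8) (p. 39); §3.9 (pp. 63–65)]
-/

noncomputable section

namespace Summit.CriticalPhenomena.PercolationContinuityZ3.Theorems

namespace FK

open MeasureTheory Set Literature.Probability.LatticeModels Literature.Probability.Percolation
open scoped Classical

variable {V : Type*} [Fintype V]

/-! ### The cluster partition as the set of connected pairs -/

/-- The set of connected pairs of the configuration `ω` (the cluster partition; coarsening = inclusion).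
[cite: Grimmett2006, §1.3 (p. 10)] -/
def connSet (ω : BondConfig V) : Set (Sym2 V) := {e | ∀ u v, e = s(u, v) → (openGraph ω).Reachable u v}

omit [Fintype V] in
/-- `s(u, v) ∈ connSet ω ↔ u ↔ v`. [folklore] -/
theorem mk_mem_connSet_iff (ω : BondConfig V) (u v : V) : s(u, v) ∈ connSet ω ↔ (openGraph ω).Reachable u v := by
  refine ⟨fun h => h u v rfl, fun h a b hab => ?_⟩
  rw [Sym2.eq_iff] at hab
  rcases hab with ⟨rfl, rfl⟩ | ⟨rfl, rfl⟩
  · exact h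
  · exact h.symm

omit [Fintype V] in
/-- The set of connected pairs grows with the configuration. [folklore] -/
theorem connSet_mono {ω ω' : BondConfig V} (h : ω ≤ ω') : connSet ω ⊆ connSet ω' :=
  fun _ he u v huv => isUpperSet_openConn u v h (he u v huv)

/-- The event "the cluster partition lies in the family `𝒰`" (an up-set of `𝒰` = coarsening-closed family).
[cite: Grimmett2006, §1.3 (p. 10)] -/
def partIn (𝒰 : Set (Set (Sym2 V))) : Set (BondConfig V) := {ω | connSet ω ∈ 𝒰}

omit [Fintype V] in
/-- For an up-set `𝒰`, `{π ∈ 𝒰}` is an increasing event. [folklore] -/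
theorem isUpperSet_partIn {𝒰 : Set (Set (Sym2 V))} (h𝒰 : IsUpperSet 𝒰) : IsUpperSet (partIn (V := V) 𝒰) :=
  fun _ _ hle hω => h𝒰 (connSet_mono hle) hω

omit [Fintype V] in
/-- `{π ∋ uv} = {u ↔ v}`. [folklore] -/
theorem partIn_mem_eq_openConn (u v : V) : partIn {P : Set (Sym2 V) | s(u, v) ∈ P} = openConn u v := by
  ext ω; exact mk_mem_connSet_iff ω u v

omit [Fintype V] in
/-- `{C_x ∈ 𝒰} = {π ∈ 𝒰'}` with `𝒰' = {P | {y | xy ∈ P} ∈ 𝒰}`. [folklore] -/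
theorem clusterIn_eq_partIn (x : V) (𝒰 : Set (Set V)) :
    clusterIn x 𝒰 = partIn {P : Set (Sym2 V) | {y | s(x, y) ∈ P} ∈ 𝒰} := by
  ext ω
  simp only [clusterIn, partIn, Set.mem_setOf_eq]
  have : {y | s(x, y) ∈ connSet ω} = openCluster ω x := by
    ext y; rw [Set.mem_setOf_eq, mk_mem_connSet_iff]; rfl
  rw [this]

omit [Fintype V] in
/-- The family `{P | {y | xy ∈ P} ∈ 𝒰}` is an up-set when `𝒰` is. [folklore] -/
theorem isUpperSet_clusterFamily (x : V) {𝒰 : Set (Set V)} (h𝒰 : IsUpperSet 𝒰) :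
    IsUpperSet {P : Set (Sym2 V) | {y | s(x, y) ∈ P} ∈ 𝒰} :=
  fun _ _ hle hP => h𝒰 (fun _ hy => hle hy) hP

/-! ### PA — positive association of the cluster partition -/

/-- **Positive association of the cluster partition on the vertex type `V`** (PA): for every weight vector and all up-sets `𝒰, 𝒱`
of pair-sets (coarsening-closed families of partitions), `φ(π ∈ 𝒰)·φ(π ∈ 𝒱) ≤ φ(π ∈ 𝒰 ∩ 𝒱)`, `φ = φ_{w,q}`.  For `q ≥ 1` FKG; for
`0 < q < 1` conjectural (the edges are negatively correlated there, but edge events are not partition-measurable).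
[cite: Grimmett2006, Thm. (3.8) (p. 39); §3.9 (p. 63)] [cite: AyyerLinussonRavichandran2025, §7 eq. (13)–(15) (p. 22)] -/
def PartitionAssocOn (V : Type*) [Fintype V] (q : ℝ) : Prop :=
  ∀ (w : Sym2 V → unitInterval) (𝒰 𝒱 : Set (Set (Sym2 V))), IsUpperSet 𝒰 → IsUpperSet 𝒱 →
    (rcMeasureW w q ∅).real (partIn 𝒰) * (rcMeasureW w q ∅).real (partIn 𝒱) ≤ (rcMeasureW w q ∅).real (partIn 𝒰 ∩ partIn 𝒱)

/-- **PA for `φ_{w,q}` on every finite weighted graph** (vertex types `Fin n`). [cite: Grimmett2006, Thm. (3.8) (p. 39); §3.9 (p. 63)] -/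
def PartitionAssocFK (q : ℝ) : Prop := ∀ n : ℕ, PartitionAssocOn (Fin n) q

/-- **PA for every `q > 0`.**  CONJECTURE-SHAPED STATEMENT, NOT asserted.  Evidence (fk-1 g7, 2026-08-21, exact rationals): 6,000
covariances of pairs of coarsening-up-sets on random weighted graphs with `≤ 7` vertices, `q ∈ [10⁻³, 19/20]`: 0 negative; levelwise
on the double model (`#{π_red ∈ 𝒰, π_blue ∈ 𝒱} ≤ #{π_red ∈ 𝒰 ∩ 𝒱}` at each level of `k(S)+k(E∖S)`): 0 of 17,850.  Implies
`ClusterAssocFKPos` (hence `HubFKPos`) and `PairConnPosFKPos`.  The partition is NOT monotone in a non-adjacent edge for `q < 1`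
(the cluster-dominance test fails in 482/638 instances), so PA cannot come from a monotone coupling.
[cite: AyyerLinussonRavichandran2025, §7 eq. (13)–(15), Conj. 7.1 (p. 22)] [cite: Grimmett2006, §3.9 (pp. 63–65)] -/
@[conjecture] def PartitionAssocFKPos : Prop := ∀ q : ℝ, 0 < q → PartitionAssocFK q

/-- **PA holds for `q ≥ 1`** (FKG, Grimmett 2006 Thm. (3.8), for the increasing events `{π ∈ 𝒰}`, `{π ∈ 𝒱}`).
[cite: Grimmett2006, Thm. (3.8) (p. 39)] -/
theorem partitionAssocOn_of_one_le {q : ℝ} (hq : 1 ≤ q) : PartitionAssocOn V q :=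
  fun w _ _ h𝒰 h𝒱 => rcMeasureW_fkg (w := w) hq ∅ (isUpperSet_partIn h𝒰) (isUpperSet_partIn h𝒱)

/-- `PartitionAssocFK q` for `q ≥ 1`. [cite: Grimmett2006, Thm. (3.8) (p. 39)] -/
theorem partitionAssocFK_of_one_le {q : ℝ} (hq : 1 ≤ q) : PartitionAssocFK q := fun _ => partitionAssocOn_of_one_le hq

/-- **PA ⇒ CA**: the cluster of `x` is a monotone function of the partition. [cite: Grimmett2006, §3.9 (p. 63)] -/
theorem clusterAssocOn_of_partitionAssocOn {q : ℝ} (h : PartitionAssocOn V q) : ClusterAssocOn V q := by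
  intro w x 𝒰 𝒱 h𝒰 h𝒱
  rw [clusterIn_eq_partIn x 𝒰, clusterIn_eq_partIn x 𝒱]
  exact h w _ _ (isUpperSet_clusterFamily x h𝒰) (isUpperSet_clusterFamily x h𝒱)

/-- **`PartitionAssocFK q → ClusterAssocFK q`.** [cite: Grimmett2006, §3.9 (p. 63)] -/
theorem clusterAssocFK_of_partitionAssocFK {q : ℝ} (h : PartitionAssocFK q) : ClusterAssocFK q :=
  fun n => clusterAssocOn_of_partitionAssocOn (h n)

/-- **PA ⇒ pairwise positive correlation of connection events** `φ(x ↔ y)φ(u ↔ v) ≤ φ(x ↔ y, u ↔ v)` (`0 < q`).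
[cite: AyyerLinussonRavichandran2025, §7 eq. (13) (p. 22)] -/
theorem pairConnPosUnder_of_partitionAssocOn {q : ℝ} (hq0 : 0 < q) (h : PartitionAssocOn V q) (w : Sym2 V → unitInterval)
    (x y u v : V) : PairConnPosUnder (rcMeasureW w q ∅) x y u v := by
  haveI := isProbabilityMeasure_rcMeasureW w hq0 (∅ : Set V)
  unfold PairConnPosUnder
  rw [probReal_univ, one_mul]
  have key := h w {P | s(x, y) ∈ P} {P | s(u, v) ∈ P} (fun _ _ hle hP => hle hP) (fun _ _ hle hP => hle hP)
  rwa [partIn_mem_eq_openConn, partIn_mem_eq_openConn] at key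

/-- **`PartitionAssocFK q → PairConnPosFK q`** (`0 < q`). [cite: AyyerLinussonRavichandran2025, §7 eq. (13) (p. 22)] -/
theorem pairConnPosFK_of_partitionAssocFK {q : ℝ} (hq0 : 0 < q) (h : PartitionAssocFK q) : PairConnPosFK q :=
  fun n w x y u v => pairConnPosUnder_of_partitionAssocOn hq0 (h n) w x y u v

/-- **Conjecture nodes: `PartitionAssocFKPos → ClusterAssocFKPos`, `→ HubFKPos`, `→ PairConnPosFKPos`.**
[cite: AyyerLinussonRavichandran2025, §7 eq. (13)–(15), Conj. 7.1 (p. 22)] -/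
theorem clusterAssocFKPos_of_partitionAssocFKPos (h : PartitionAssocFKPos) : ClusterAssocFKPos :=
  fun q hq0 => clusterAssocFK_of_partitionAssocFK (h q hq0)

/-- `PartitionAssocFKPos → HubFKPos`. [cite: AyyerLinussonRavichandran2025, §7 eq. (13), Conj. 7.1 (p. 22)] -/
theorem hubFKPos_of_partitionAssocFKPos (h : PartitionAssocFKPos) : HubFKPos :=
  hubFKPos_of_clusterAssocFKPos (clusterAssocFKPos_of_partitionAssocFKPos h)

/-- `PartitionAssocFKPos → PairConnPosFKPos`. [cite: AyyerLinussonRavichandran2025, §7 eq. (13) (p. 22)] -/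
theorem pairConnPosFKPos_of_partitionAssocFKPos (h : PartitionAssocFKPos) : PairConnPosFKPos :=
  fun q hq0 => pairConnPosFK_of_partitionAssocFK hq0 (h q hq0)

end FK

end Summit.CriticalPhenomena.PercolationContinuityZ3.Theorems

end
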